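import Literature.NumberTheory.Automorphic.SLTwoTreeUnramifiedEllipticFixedBall   -- ★ (this seat): cyclic frames, conjugation to the torus form, fixed-set transport (§1–§3 generic)
import Literature.NumberTheory.Automorphic.SLTwoTreeQuadraticTorusEisenstein      -- ★ (W′1) VI (A-p17 (g23)): Eisenstein `δ_m = 2q^m`, the fixed-shell coefficients, `hE` from Eisenstein
import HarnessLib

/-!
# Fixed vertices of a RAMIFIED-ELLIPTIC element of `GL₂(F)` on the tree of `SL₂(F)`: the EDGE-centred ball `(q − 1)·#Fix(g) + 2 = 2·q^{n+1}`
# (Labesse–Langlands 1979 §2 p. 8 «`δ_m = 2q^m` if `L` is ramified»; Serre, *Trees* II.1.1; Kottwitz 1988 §2)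

Topic `NumberTheory/Automorphic`; namespace `Literature.NumberTheory.Automorphic.HermitianLatticeTree` (ROAD W's).  KERNEL mathematics only: theorems, no definition, no
named fact, no instance, no notation, no `sorry`.  Cell `pub/hodgecm-mathlib` (D-0151), crux H413 = `stmt-HodgeConjecture-24833`; «S3-ram» seeding wave (LEAD F0P3a-plan (g12)
T11-62; owner F0P3a-p06 (g15)); seat A-p12 (g23).  Organ «TYPE-(2) DESCENT TO TORUS FORM», `GL₂(F)` half, sub-type 2r (the EDGE-centred twin of ★
`SLTwoTreeUnramifiedEllipticFixedBall`): a type-(2) `γ_H` of ODD discriminant depth `2n + 1` at a tame-RAMIFIED CM place has eigen-ratio field `L⁺_v(√(εϖ))`, the OTHER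
ramified quadratic extension of `L⁺_v` (not `L_w`); its descended `g ∈ GL₂(L⁺_v)` has `tr² g − 4 det g = π₁·z²` with `|π₁| = |ϖ_v|` and fixes the ball of radius `n` about
an EDGE of the tree of `SL₂(L⁺_v)`.  Consumer: STUB B₂ of the P-2-ram skeleton (α₂) v0.2 (7cc84811), sub-type 2r.
HONEST LABEL: HC_CM is proved only modulo the cell's 2 remaining named inputs (hLiu418 24832, h413 24833) until rung 0 closes; nothing printed is asserted here.

THE MATHEMATICS.  In the EISENSTEIN shape `(u, v) = (0, π₁)`, `|π₁| = |ϖ|` (`τ² = π₁`, `E′ = F(τ)` RAMIFIED, `𝒪_{E′} = 𝒪 ⊕ 𝒪τ`) the torus `F[τ]^×` fixes the EDGE `{v₀, γτ·v₀}` of the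
tree and its shells have `δ_m = 2q^m` vertices (★ VI `ncard_setOf_shellIndex_eq_two_mul_pow_of_eisenstein`); a unit `1 + eτ` with `|e| = |ϖ|ⁿ` fixes exactly the shells
`≤ n` (★ IV), i.e. `2(1 + q + ⋯ + qⁿ)` vertices: **`(q − 1)·#{x | d x ≤ n} + 2 = 2·q^{n+1}`** (§1, induction on `n`).  If `g ∈ GL₂(F)` has `tr g = t ≠ 0`, `det g = d`,
`t² − 4d = π₁·z²`, `z ≠ 0`, `|z∕t| = |ϖ|ⁿ` (`2 ≠ 0` in `F`), then `g ~ (t∕2)(1 + eτ)`, `e = z∕t` (★ `exists_conj_eq_smul_regRepOne`) and fixed sets transport (★ §3 of the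
unramified file), whence the HEAD **`(q − 1)·#{x | g·x = x} + 2 = 2·q^{n+1}`** (§2).  Parity dictionary at a tame-ramified CM place (`e(w|v) = 2`): `|tr² − 4det|_w = exp(−2N)` with
`N = 2n + 1` ODD ⟺ this case (ref5 R-231 check of this seat's finding).

* §1 `ncard_setOf_shellIndex_le_succ_of_eisenstein` (`#B(n+1) = #B(n) + 2q^{n+1}`), `ncard_setOf_shellIndex_le_of_eisenstein` (`(q−1)·#B(n) + 2 = 2q^{n+1}`),
  `ncard_setOf_glVertexAct_torus_eq_self_of_eisenstein` (the same for `Fix(a + bτ)`, `|b| = |ϖ|ⁿ`, `|det| = 1`).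
* §2 HEAD `ncard_setOf_glVertexAct_eq_self_of_ramified_elliptic`.

## References
* [LabesseLanglands1979] J.-P. Labesse, R. P. Langlands, *L-indistinguishability for SL(2)*, Canad. J. Math. 31 (1979), §2 p. 8 (`δ_m = 2q^m` if `L` is ramified).
* [Serre1980Trees] J.-P. Serre, *Trees* (1980), Ch. II §1.1, §1.3 (edge-centred balls; `GL₂` acts with inversions).
* [Kottwitz1988] R. E. Kottwitz, *Tamagawa numbers*, Ann. of Math. 127 (1988), §2.
-/

set_option autoImplicit false

noncomputable section

open scoped ValuativeRel Matrix MatrixGroups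
open Matrix ValuativeRel

namespace Literature.NumberTheory.Automorphic.HermitianLatticeTree

open Literature.NumberTheory.Automorphic Literature.NumberTheory.LocalFields

variable {F : Type*} [Field F] [ValuativeRel F] {ϖ : F} (hϖ : IsUniformizingElement ϖ) [IsDiscreteValuationRing 𝒪[F]]

/-! ## §1 The edge-centred ball in the Eisenstein shape -/

include hϖ in
/-- **THE BALL RECURSION, EISENSTEIN SHAPE**: `#{x | d x ≤ n+1} = #{x | d x ≤ n} + 2·q^{n+1}` and the balls are finite (★ VI `δ_m = 2q^m`).
[cite: LabesseLanglands1979, §2 p. 8] [cite: Serre1980Trees, Ch. II §1.1] -/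
theorem ncard_setOf_shellIndex_le_succ_of_eisenstein [Finite (IsLocalRing.ResidueField 𝒪[F])] {u v : F} (hu : u ∈ 𝒪[F]) (hu1 : valuation F u < 1)
    (hv1 : valuation F v = valuation F ϖ) {γτ : GL (Fin 2) F} (hγτ : (γτ : Matrix (Fin 2) (Fin 2) F) = !![0, v; 1, u])
    {r : ℕ → GL (Fin 2) F} (hr : ∀ m, (r m : Matrix (Fin 2) (Fin 2) F) = Matrix.diagonal ![1, ϖ ^ m])
    (v₀ : {M : Submodule 𝒪[F] (Fin 2 → F) // IsSpecialLattice (RingHom.id F) ϖ !![(0 : F), 1; -1, 0] M})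
    (hv₀ : v₀.1 = latt (1 : Matrix (Fin 2) (Fin 2) F))
    {d : {M : Submodule 𝒪[F] (Fin 2 → F) // IsSpecialLattice (RingHom.id F) ϖ !![(0 : F), 1; -1, 0] M} → ℕ}
    (hd : ∀ x, ∃ (t gm : GL (Fin 2) F) (c e : F), (t : Matrix (Fin 2) (Fin 2) F) = !![c, e * v; e, c + e * u] ∧
      (gm : Matrix (Fin 2) (Fin 2) F) = Matrix.diagonal ![1, ϖ ^ d x] ∧ x = glVertexAct hϖ (t * gm) v₀)
    (hd' : ∀ (x) (t gm : GL (Fin 2) F) (c e : F) (m : ℕ), (t : Matrix (Fin 2) (Fin 2) F) = !![c, e * v; e, c + e * u] →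
      (gm : Matrix (Fin 2) (Fin 2) F) = Matrix.diagonal ![1, ϖ ^ m] → x = glVertexAct hϖ (t * gm) v₀ → d x = m) (n : ℕ) :
    {x | d x ≤ n}.Finite ∧ {x | d x ≤ n + 1}.ncard = {x | d x ≤ n}.ncard + 2 * Nat.card (IsLocalRing.ResidueField 𝒪[F]) ^ (n + 1) := by
  have hfin : ∀ k, {x | d x ≤ k}.Finite := by
    intro k
    have heq : {x | d x ≤ k} = ⋃ i ∈ Finset.range (k + 1), {x | d x = i} := by
      ext x
      simp only [Set.mem_setOf_eq, Set.mem_iUnion, Finset.mem_range, exists_prop]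
      exact ⟨fun h => ⟨d x, Nat.lt_succ_of_le h, rfl⟩, fun ⟨i, hi, hx⟩ => hx ▸ Nat.le_of_lt_succ hi⟩
    rw [heq]
    exact Set.Finite.biUnion (Finset.finite_toSet _) fun i _ => (ncard_setOf_shellIndex_eq_two_mul_pow_of_eisenstein hϖ hu hu1 hv1 hγτ hr v₀ hv₀ hd hd' i).1
  refine ⟨hfin n, ?_⟩
  have hunion : {x | d x ≤ n + 1} = {x | d x ≤ n} ∪ {x | d x = n + 1} := by
    ext x
    simp only [Set.mem_setOf_eq, Set.mem_union]
    omega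
  have hdisj : Disjoint {x | d x ≤ n} {x | d x = n + 1} := by
    rw [Set.disjoint_left]
    intro x hx hx'
    simp only [Set.mem_setOf_eq] at hx hx'
    omega
  have hshell := ncard_setOf_shellIndex_eq_two_mul_pow_of_eisenstein hϖ hu hu1 hv1 hγτ hr v₀ hv₀ hd hd' (n + 1)
  rw [hunion, Set.ncard_union_eq hdisj (hfin n) hshell.1, hshell.2]

include hϖ in
/-- **THE EDGE-CENTRED BALL OF THE `(q+1)`-REGULAR TREE**: in the Eisenstein shape, `(q − 1)·#{x | d x ≤ n} + 2 = 2·q^{n+1}`, i.e. `#B(n) = 2(1 + q + ⋯ + qⁿ)` — the vertices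
at distance `≤ n` from either endpoint of the edge fixed by the ramified torus (`#B(0) = 2`, ★ VI). [cite: Serre1980Trees, Ch. II §1.1] [cite: LabesseLanglands1979, §2 p. 8] -/
theorem ncard_setOf_shellIndex_le_of_eisenstein [Finite (IsLocalRing.ResidueField 𝒪[F])] {u v : F} (hu : u ∈ 𝒪[F]) (hu1 : valuation F u < 1)
    (hv1 : valuation F v = valuation F ϖ) {γτ : GL (Fin 2) F} (hγτ : (γτ : Matrix (Fin 2) (Fin 2) F) = !![0, v; 1, u])
    {r : ℕ → GL (Fin 2) F} (hr : ∀ m, (r m : Matrix (Fin 2) (Fin 2) F) = Matrix.diagonal ![1, ϖ ^ m])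
    (v₀ : {M : Submodule 𝒪[F] (Fin 2 → F) // IsSpecialLattice (RingHom.id F) ϖ !![(0 : F), 1; -1, 0] M})
    (hv₀ : v₀.1 = latt (1 : Matrix (Fin 2) (Fin 2) F))
    {d : {M : Submodule 𝒪[F] (Fin 2 → F) // IsSpecialLattice (RingHom.id F) ϖ !![(0 : F), 1; -1, 0] M} → ℕ}
    (hd : ∀ x, ∃ (t gm : GL (Fin 2) F) (c e : F), (t : Matrix (Fin 2) (Fin 2) F) = !![c, e * v; e, c + e * u] ∧
      (gm : Matrix (Fin 2) (Fin 2) F) = Matrix.diagonal ![1, ϖ ^ d x] ∧ x = glVertexAct hϖ (t * gm) v₀)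
    (hd' : ∀ (x) (t gm : GL (Fin 2) F) (c e : F) (m : ℕ), (t : Matrix (Fin 2) (Fin 2) F) = !![c, e * v; e, c + e * u] →
      (gm : Matrix (Fin 2) (Fin 2) F) = Matrix.diagonal ![1, ϖ ^ m] → x = glVertexAct hϖ (t * gm) v₀ → d x = m) (n : ℕ) :
    (Nat.card (IsLocalRing.ResidueField 𝒪[F]) - 1) * {x | d x ≤ n}.ncard + 2 = 2 * Nat.card (IsLocalRing.ResidueField 𝒪[F]) ^ (n + 1) := by
  obtain ⟨k, hk⟩ : ∃ k, Nat.card (IsLocalRing.ResidueField 𝒪[F]) = k + 1 := ⟨_, (Nat.succ_pred_eq_of_pos Nat.card_pos).symm⟩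
  rw [hk, Nat.add_sub_cancel]
  induction n with
  | zero =>
    have h0 : {x | d x ≤ 0} = {x | d x = 0} := by ext x; simp only [Set.mem_setOf_eq, Nat.le_zero]
    have h := (ncard_setOf_shellIndex_eq_two_mul_pow_of_eisenstein hϖ hu hu1 hv1 hγτ hr v₀ hv₀ hd hd' 0).2
    rw [hk] at h
    rw [h0, h]
    ring
  | succ n ih =>
    have hrec := (ncard_setOf_shellIndex_le_succ_of_eisenstein hϖ hu hu1 hv1 hγτ hr v₀ hv₀ hd hd' n).2
    rw [hk] at hrec
    rw [hrec, mul_add, add_right_comm, ih]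
    ring

include hϖ in
/-- **THE NUMBER OF VERTICES FIXED BY A UNIT OF THE EISENSTEIN ORDER**: for `γ = (a, bv; b, a+bu)` (`a b ∈ 𝒪`, `|det γ| = 1`, `|b| = |ϖ|ⁿ`),
`(q − 1)·#{x | γ·x = x} + 2 = 2·q^{n+1}` — the edge-centred ball of radius `n` (`Fix(γ) = {x | d x ≤ n}`, ★ IV). [cite: LabesseLanglands1979, §2 p. 8] [cite: Kottwitz1988, §2] -/
theorem ncard_setOf_glVertexAct_torus_eq_self_of_eisenstein [Finite (IsLocalRing.ResidueField 𝒪[F])] {u v a b : F} (hu : u ∈ 𝒪[F]) (hu1 : valuation F u < 1)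
    (hv1 : valuation F v = valuation F ϖ) (ha : a ∈ 𝒪[F]) (hb : b ∈ 𝒪[F]) {n : ℕ} (hbn : valuation F b = valuation F ϖ ^ n)
    {γ : GL (Fin 2) F} (hγ : (γ : Matrix (Fin 2) (Fin 2) F) = !![a, b * v; b, a + b * u]) (hγdet : valuation F (γ : Matrix (Fin 2) (Fin 2) F).det = 1)
    {γτ : GL (Fin 2) F} (hγτ : (γτ : Matrix (Fin 2) (Fin 2) F) = !![0, v; 1, u])
    {r : ℕ → GL (Fin 2) F} (hr : ∀ m, (r m : Matrix (Fin 2) (Fin 2) F) = Matrix.diagonal ![1, ϖ ^ m])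
    (v₀ : {M : Submodule 𝒪[F] (Fin 2 → F) // IsSpecialLattice (RingHom.id F) ϖ !![(0 : F), 1; -1, 0] M})
    (hv₀ : v₀.1 = latt (1 : Matrix (Fin 2) (Fin 2) F))
    {d : {M : Submodule 𝒪[F] (Fin 2 → F) // IsSpecialLattice (RingHom.id F) ϖ !![(0 : F), 1; -1, 0] M} → ℕ}
    (hd : ∀ x, ∃ (t gm : GL (Fin 2) F) (c e : F), (t : Matrix (Fin 2) (Fin 2) F) = !![c, e * v; e, c + e * u] ∧
      (gm : Matrix (Fin 2) (Fin 2) F) = Matrix.diagonal ![1, ϖ ^ d x] ∧ x = glVertexAct hϖ (t * gm) v₀)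
    (hd' : ∀ (x) (t gm : GL (Fin 2) F) (c e : F) (m : ℕ), (t : Matrix (Fin 2) (Fin 2) F) = !![c, e * v; e, c + e * u] →
      (gm : Matrix (Fin 2) (Fin 2) F) = Matrix.diagonal ![1, ϖ ^ m] → x = glVertexAct hϖ (t * gm) v₀ → d x = m) :
    (Nat.card (IsLocalRing.ResidueField 𝒪[F]) - 1) * {x | glVertexAct hϖ γ x = x}.ncard + 2 = 2 * Nat.card (IsLocalRing.ResidueField 𝒪[F]) ^ (n + 1) := by
  rw [setOf_glVertexAct_torus_eq_self_eq_setOf_shellIndex_le hϖ hu (mem_integer_of_valuation_eq_uniformizer hϖ hv1) ha hb hbn hγ hγdet v₀ hv₀ hd]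
  exact ncard_setOf_shellIndex_le_of_eisenstein hϖ hu hu1 hv1 hγτ hr v₀ hv₀ hd hd' n

/-! ## §2 The edge ball of a ramified-elliptic element -/

include hϖ in
/-- **THE EDGE BALL OF A RAMIFIED-ELLIPTIC ELEMENT** (HEAD).  Let `|π₁| = |ϖ|`, `(2 : F) ≠ 0`, and let `g ∈ GL₂(F)` have `tr g = t ≠ 0`, `det g = d`, `t² − 4d = π₁·z²` with `z ≠ 0`
and `|z · t⁻¹| = |ϖ|ⁿ` (the DEEP ramified-elliptic shape of the descended element of a type-(2) `γ_H` of odd discriminant depth `2n + 1` at a tame-ramified place, `π₁` in the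
class of the OTHER ramified quadratic extension).  Then **`(q − 1)·#{x | g·x = x} + 2 = 2·q^{n+1}`** (`q = #𝓀_F`): `g ~ (t∕2)(1 + eτ)`, `e = z∕t`, `τ² = π₁` (★
`exists_conj_eq_smul_regRepOne`), transport (★ §3 of the unramified file), and §1 for the unit `1 + eτ` of the Eisenstein order `(u, v) = (0, π₁)`.
[cite: LabesseLanglands1979, §2 p. 8] [cite: Serre1980Trees, Ch. II §1.1] [cite: Kottwitz1988, §2] -/
theorem ncard_setOf_glVertexAct_eq_self_of_ramified_elliptic [Finite (IsLocalRing.ResidueField 𝒪[F])] (h2 : (2 : F) ≠ 0)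
    {π₁ : F} (hπ₁ : valuation F π₁ = valuation F ϖ)
    {g : GL (Fin 2) F} {t d z : F} (htr : (g : Matrix (Fin 2) (Fin 2) F).trace = t) (hdet : (g : Matrix (Fin 2) (Fin 2) F).det = d) (ht : t ≠ 0) (hz : z ≠ 0)
    (hD : t ^ 2 - 4 * d = π₁ * z ^ 2) {n : ℕ} (hn : valuation F (z * t⁻¹) = valuation F ϖ ^ n)
    (v₀ : {M : Submodule 𝒪[F] (Fin 2 → F) // IsSpecialLattice (RingHom.id F) ϖ !![(0 : F), 1; -1, 0] M}) (hv₀ : v₀.1 = latt (1 : Matrix (Fin 2) (Fin 2) F)) :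
    (Nat.card (IsLocalRing.ResidueField 𝒪[F]) - 1) * {x : {M : Submodule 𝒪[F] (Fin 2 → F) // IsSpecialLattice (RingHom.id F) ϖ !![(0 : F), 1; -1, 0] M} | glVertexAct hϖ g x = x}.ncard + 2 =
      2 * Nat.card (IsLocalRing.ResidueField 𝒪[F]) ^ (n + 1) := by
  have h0 := hϖ.ne_zero
  have hπO : π₁ ∈ 𝒪[F] := mem_integer_of_valuation_eq_uniformizer hϖ hπ₁
  have hπ0 : π₁ ≠ 0 := fun h => by rw [h, map_zero] at hπ₁; exact hϖ.ne_zero ((Valuation.zero_iff _).1 hπ₁.symm)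
  have hu1 : valuation F (0 : F) < 1 := by rw [map_zero]; exact zero_lt_one
  have hE := quadNormForm_integral_of_eisenstein hϖ (zero_mem _) hu1 hπ₁
  -- the torus form and the conjugation
  obtain ⟨γ, h, hγ, hconj⟩ := exists_conj_eq_smul_regRepOne h2 htr hdet ht hz hπ0 hD
  set e : F := z / t with he
  have heO : e ∈ 𝒪[F] := by
    rw [Valuation.mem_integer_iff, he, div_eq_mul_inv, hn]; exact pow_le_one₀ zero_le hϖ.valuation_le_one
  have hev : valuation F e = valuation F ϖ ^ n := by rw [he, div_eq_mul_inv, hn]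
  -- the unit `1 + eτ` of the Eisenstein order: `det = 1 − e²π₁` with `|e²π₁| < 1`
  have hNdet : valuation F ((1 : F) ^ 2 + 1 * e * 0 - e ^ 2 * π₁) = 1 := by
    have hlt : valuation F (e ^ 2 * π₁) < valuation F (1 : F) := by
      rw [map_mul, hπ₁, map_pow, Valuation.map_one]
      exact mul_lt_one_of_nonneg_of_lt_one_right (pow_le_one₀ zero_le ((Valuation.mem_integer_iff _ _).1 heO)) zero_le hϖ.valuation_lt_one
    have hq : (1 : F) ^ 2 + 1 * e * 0 - e ^ 2 * π₁ = 1 - e ^ 2 * π₁ := by ring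
    rw [hq, Valuation.map_sub_eq_of_lt_left _ hlt, Valuation.map_one]
  have hdet0 : (!![(1 : F), e * π₁; e, 1 + e * 0]).det ≠ 0 := by
    rw [QuadraticRegularRep.det_regRep]; intro h'; rw [h', map_zero] at hNdet; exact zero_ne_one hNdet
  set γ₁ : GL (Fin 2) F := Matrix.GeneralLinearGroup.mk'' _ (isUnit_iff_ne_zero.2 hdet0) with hγ₁
  have hγ₁coe : (γ₁ : Matrix (Fin 2) (Fin 2) F) = !![(1 : F), e * π₁; e, 1 + e * 0] := rfl
  have hγ₁det : valuation F (γ₁ : Matrix (Fin 2) (Fin 2) F).det = 1 := by rw [hγ₁coe, QuadraticRegularRep.det_regRep]; exact hNdet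
  have hγsmul : (γ : Matrix (Fin 2) (Fin 2) F) = (t / 2) • (γ₁ : Matrix (Fin 2) (Fin 2) F) := by rw [hγ, hγ₁coe]
  have ht2 : t / 2 ≠ 0 := div_ne_zero ht h2
  have hfix : {x : {M : Submodule 𝒪[F] (Fin 2 → F) // IsSpecialLattice (RingHom.id F) ϖ !![(0 : F), 1; -1, 0] M} | glVertexAct hϖ g x = x}.ncard =
      {x | glVertexAct hϖ γ₁ x = x}.ncard := by
    rw [← ncard_setOf_glVertexAct_conj_eq_self hϖ g h, hconj, setOf_glVertexAct_smul_eq_self hϖ ht2 hγsmul]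
  rw [hfix]
  -- the shell machinery of (W′1) for the Eisenstein datum `(0, π₁)`
  have hdetτ : (!![(0 : F), π₁; 1, 0]).det ≠ 0 := by rw [Matrix.det_fin_two_of]; simpa using hπ0
  set γτ : GL (Fin 2) F := Matrix.GeneralLinearGroup.mk'' _ (isUnit_iff_ne_zero.2 hdetτ) with hγτ
  have hγτcoe : (γτ : Matrix (Fin 2) (Fin 2) F) = !![(0 : F), π₁; 1, 0] := rfl
  obtain ⟨r, hr⟩ := exists_shellRep_fn (F := F) h0
  obtain ⟨dd, hd, hd'⟩ := exists_shellIndex hϖ (zero_mem _) hπO hE v₀ hv₀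
  exact ncard_setOf_glVertexAct_torus_eq_self_of_eisenstein hϖ (zero_mem _) hu1 hπ₁ (one_mem _) heO hev hγ₁coe hγ₁det hγτcoe hr v₀ hv₀ hd hd'

end Literature.NumberTheory.Automorphic.HermitianLatticeTree

end
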